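import Literature.Analysis.FluidPDE.ForcedHeatDuhamelTime
import HarnessLib

/-!
# The time derivative of the Duhamel integral of `C²` data, and the passage from right
# derivatives to derivatives

Analysis/PDE support file (everything proved; no definitions, no named facts). Third input of the
local well-posedness theory of semilinear heat systems in the heat-semigroup form of the tree:
once a mild solution `u(t) = e^{tΔ}u₀ + ∫₀ᵗ e^{(t−s)Δ}g(s) ds` is known to have `C²`-bounded,
time-continuous data `g`, it is a classical solution. The Duhamel principle in this direction
(Evans, *PDE*, §2.3.1 (c), Thm. 2; Lunardi, *Analytic semigroups …*, Prop. 4.1.2):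

* `laplacian_duhamel_apply` — `Δ(∫₀ᵗ e^{(t−s)Δ}g(s) ds)(x) = ∫₀ᵗ e^{(t−s)Δ}(Δg(s))(x) ds` for a
  measurable family of `C²`-bounded slices (derivatives fall on the data);
* `hasDerivWithinAt_duhamel_Ici` — **the right time derivative of the Duhamel integral**: if
  moreover `s ↦ g(s, x)` is right-continuous at `t ≥ 0`, then `τ ↦ ∫₀^τ e^{(τ−s)Δ}g(s)(x) ds` has
  right derivative `∫₀ᵗ e^{(t−s)Δ}Δg(s)(x) ds + g(t, x)` at `t` (split `∫₀^τ = ∫₀ᵗ + ∫ₜ^τ`;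
  dominated convergence with the heat equation `∂_σ e^{σΔ}k = e^{σΔ}Δk` on the first piece, the
  bound `‖e^{hΔ}k − k‖ ≤ d‖D²k‖h` and right-continuity on the second);
* `hasDerivAt_of_hasDerivWithinAt_Ici` — a continuous function with a continuous right
  derivative on an open interval is differentiable there (comparison with the primitive,
  `eq_of_has_deriv_right_eq`).

## References

* L. C. Evans, *Partial Differential Equations*, 2nd ed., AMS (2010), §2.3.1 (c), Thm. 2
  (solution of the nonhomogeneous heat equation by Duhamel's principle). [Evans2010]
* A. Lunardi, *Analytic Semigroups and Optimal Regularity in Parabolic Problems*, Birkhäuser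
  (1995), Prop. 4.1.2 (mild solutions with regular data are classical). [folklore]
-/

noncomputable section

open MeasureTheory Set Function Filter Metric Real
open _root_.Topology
open scoped ENNReal NNReal ContDiff Laplacian

namespace Literature.Analysis.PDE

namespace SemilinearHeat

open Literature.Analysis.UnboundedOperators Literature.Analysis.UnboundedOperators.HeatHolder
open Literature.Analysis.FluidPDE

-- nested operator types `E →L[ℝ] E →L[ℝ] F`
set_option maxSynthPendingDepth 3

variable {E : Type*} [NormedAddCommGroup E] [InnerProductSpace ℝ E] [FiniteDimensional ℝ E]
  [MeasurableSpace E] [BorelSpace E]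
variable {F : Type*} [NormedAddCommGroup F] [NormedSpace ℝ F] [CompleteSpace F]

/-! ### The Laplacian of the Duhamel integral -/

/-- **The Laplacian falls on `C²`-bounded data**:
`Δ(∫₀ᵗ e^{(t−s)Δ}g(s) ds)(x) = ∫₀ᵗ e^{(t−s)Δ}(Δg(s))(x) ds` for a strongly measurable family of
`C²` slices with `g`, `Dg`, `D²g` bounded by `A` (`D²` under the integral,
`iteratedFDeriv_duhamel_eq`; the trace `Σᵢ D²(·)(eᵢ, eᵢ)` is a continuous linear form and
commutes with the integral and with `e^{σΔ}`). [cite: Evans2010, §2.3.1 Thm. 2] -/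
theorem laplacian_duhamel_apply {g : ℝ → E → F} {A : ℝ} (hgm : StronglyMeasurable (uncurry g))
    (hg : ∀ s, IsCkBounded 2 A (g s)) (t : ℝ) (x : E) :
    (Δ fun y => ∫ s in Ioo 0 t, heatExtension (g s) (t - s) y) x =
      ∫ s in Ioo 0 t, heatExtension (Δ (g s)) (t - s) x := by
  classical
  have hA : 0 ≤ A := (hg 0).nonneg
  set b := stdOrthonormalBasis ℝ E with hb
  -- the trace form `L M = Σᵢ M (bᵢ, bᵢ)`
  set L : ContinuousMultilinearMap ℝ (fun _ : Fin 2 => E) F →L[ℝ] F :=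
    ∑ i, ContinuousMultilinearMap.apply ℝ (fun _ : Fin 2 => E) F ![b i, b i] with hL
  have hLap : ∀ (k : E → F) (y : E), (Δ k) y = L (iteratedFDeriv ℝ 2 k y) := by
    intro k y
    rw [InnerProductSpace.laplacian_eq_iteratedFDeriv_orthonormalBasis k b]
    simp only [hL, FunLike.coe_sum, Finset.sum_apply, ContinuousMultilinearMap.apply_apply]
  -- `D²` under the integral
  have hD2 := iteratedFDeriv_duhamel_eq hgm (n := 2) (fun s => (hg s).contDiff) (Cj := fun _ => A)
    (fun j hj s y => (hg s).norm_le j hj y) t 2 le_rfl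
  have hD2x : iteratedFDeriv ℝ 2 (fun y => ∫ s in Ioo 0 t, heatExtension (g s) (t - s) y) x =
      ∫ s in Ioo 0 t, heatExtension (iteratedFDeriv ℝ 2 (g s)) (t - s) x := congrFun hD2 x
  -- measurability and integrability of the `D²` lifts
  have hm2 : StronglyMeasurable (uncurry fun s y => iteratedFDeriv ℝ 2 (g s) y) :=
    stronglyMeasurable_iteratedFDeriv_family hgm (fun s => (hg s).contDiff) 2 le_rfl
  have hb2 : ∀ s y, ‖iteratedFDeriv ℝ 2 (g s) y‖ ≤ A := fun s y => (hg s).norm_le 2 le_rfl y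
  have hint2 : IntegrableOn (fun s => heatExtension (iteratedFDeriv ℝ 2 (g s)) (t - s) x) (Ioo 0 t) volume :=
    integrableOn_lift_apply hm2 hb2 t x
  rw [hLap, hD2x, ← ContinuousLinearMap.integral_comp_comm L hint2]
  refine setIntegral_congr_fun measurableSet_Ioo fun s hs => ?_
  have hσ : 0 < t - s := sub_pos.2 hs.2
  have hc2 : Continuous (iteratedFDeriv ℝ 2 (g s)) :=
    (hg s).contDiff.continuous_iteratedFDeriv (by norm_cast)
  rw [← heatExtension_clm_comp_of_bound L hc2 (hb2 s) hσ x]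
  congr 1
  funext y
  exact (hLap (g s) y).symm

/-! ### The right time derivative of the Duhamel integral -/

omit [MeasurableSpace E] [BorelSpace E] in
/-- Mean value bound for the heat extension in time: for `C²`-bounded `k` and `0 < σ ≤ σ'`,
`‖e^{σ'Δ}k(x) − e^{σΔ}k(x)‖ ≤ d A (σ' − σ)` (`∂_σ e^{σΔ}k = e^{σΔ}Δk`, `‖Δk‖ ≤ d‖D²k‖`).
[folklore] -/
theorem norm_heatExtension_sub_heatExtension_le_of_C2 [MeasurableSpace E] [BorelSpace E]
    {k : E → F} {A : ℝ} (hk : IsCkBounded 2 A k) {σ σ' : ℝ} (hσ : 0 < σ) (hσσ' : σ ≤ σ') (x : E) :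
    ‖heatExtension k σ' x - heatExtension k σ x‖ ≤ (Module.finrank ℝ E : ℝ) * A * (σ' - σ) := by
  set d : ℝ := (Module.finrank ℝ E : ℝ)
  have h0 := hk.norm_apply_le
  have h1 := hk.norm_fderiv_le
  have h2 : ∀ y, ‖fderiv ℝ (fderiv ℝ k) y‖ ≤ A := fun y => by
    rw [norm_fderiv_fderiv_eq]; exact hk.norm_le 2 le_rfl y
  have hΔ : ∀ y, ‖(Δ k) y‖ ≤ d * A := fun y =>
    (norm_laplacian_le _ _).trans (mul_le_mul_of_nonneg_left (hk.norm_le 2 le_rfl y) (by positivity))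
  have hderiv : ∀ r ∈ Icc σ σ', HasDerivWithinAt (fun r => heatExtension k r x)
      (heatExtension (Δ k) r x) (Icc σ σ') r := fun r hr =>
    (hasDerivAt_heatExtension_time_of_bounded hk.contDiff h0 h1 h2 (hσ.trans_le hr.1) x).hasDerivWithinAt
  have hbound : ∀ r ∈ Ico σ σ', ‖heatExtension (Δ k) r x‖ ≤ d * A := fun r hr =>
    norm_heatExtension_le_of_bound hΔ (hσ.trans_le hr.1) x
  exact norm_image_sub_le_of_norm_deriv_le_segment' hderiv hbound σ' (right_mem_Icc.2 hσσ')

/-- **The right time derivative of the Duhamel integral of `C²` data.** Let `g : ℝ → E → F` be a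
strongly measurable family of `C²` slices with `g`, `Dg`, `D²g` bounded by `A`, and let
`s ↦ g(s, x)` be right-continuous at `t ≥ 0`. Then `τ ↦ J(τ) = ∫₀^τ e^{(τ−s)Δ}g(s)(x) ds` has the
right derivative `∫₀ᵗ e^{(t−s)Δ}Δg(s)(x) ds + g(t, x)` at `t`: for `τ > t`,
`J(τ) − J(t) = ∫₀ᵗ (e^{(τ−s)Δ} − e^{(t−s)Δ})g(s)(x) ds + ∫ₜ^τ e^{(τ−s)Δ}g(s)(x) ds`; the first
difference quotient converges by dominated convergence (the heat equation in the time slot and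
the mean value bound `≤ dA`), the second to `g(t, x)` since
`‖e^{(τ−s)Δ}g(s)(x) − g(t)(x)‖ ≤ dA(τ − s) + ‖g(s, x) − g(t, x)‖`.
[cite: Evans2010, §2.3.1 Thm. 2] -/
theorem hasDerivWithinAt_duhamel_Ici {g : ℝ → E → F} {A : ℝ} (hgm : StronglyMeasurable (uncurry g))
    (hg : ∀ s, IsCkBounded 2 A (g s)) {t : ℝ} (ht : 0 ≤ t) {x : E}
    (hcont : ContinuousWithinAt (fun s => g s x) (Ici t) t) :
    HasDerivWithinAt (fun τ => ∫ s in Ioo 0 τ, heatExtension (g s) (τ - s) x)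
      ((∫ s in Ioo 0 t, heatExtension (Δ (g s)) (t - s) x) + g t x) (Ici t) t := by
  have hA : 0 ≤ A := (hg 0).nonneg
  set d : ℝ := (Module.finrank ℝ E : ℝ) with hd
  have hd0 : 0 ≤ d := by positivity
  -- slice facts
  have h0 : ∀ s y, ‖g s y‖ ≤ A := fun s => (hg s).norm_apply_le
  have h1 : ∀ s y, ‖fderiv ℝ (g s) y‖ ≤ A := fun s => (hg s).norm_fderiv_le
  have h2 : ∀ s y, ‖fderiv ℝ (fderiv ℝ (g s)) y‖ ≤ A := fun s y => by
    rw [norm_fderiv_fderiv_eq]; exact (hg s).norm_le 2 le_rfl y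
  have h2' : ∀ s y, ‖iteratedFDeriv ℝ 2 (g s) y‖ ≤ A := fun s y => (hg s).norm_le 2 le_rfl y
  have hΔ : ∀ s y, ‖(Δ (g s)) y‖ ≤ d * A := fun s y =>
    (norm_laplacian_le _ _).trans (mul_le_mul_of_nonneg_left (h2' s y) hd0)
  have hderiv : ∀ s σ, 0 < σ →
      HasDerivAt (fun σ => heatExtension (g s) σ x) (heatExtension (Δ (g s)) σ x) σ :=
    fun s σ hσ => hasDerivAt_heatExtension_time_of_bounded (hg s).contDiff (h0 s) (h1 s) (h2 s) hσ x
  -- integrability of the lifts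
  have hint : ∀ τ, IntegrableOn (fun s => heatExtension (g s) (τ - s) x) (Ioo 0 τ) volume :=
    fun τ => integrableOn_lift_apply hgm h0 τ x
  have hint' : ∀ {τ}, t ≤ τ → IntegrableOn (fun s => heatExtension (g s) (τ - s) x) (Ioo 0 t) volume :=
    fun hτ => (hint _).mono_set (Ioo_subset_Ioo_right hτ)
  -- ### the slope decomposition for `τ > t`
  set J : ℝ → F := fun τ => ∫ s in Ioo 0 τ, heatExtension (g s) (τ - s) x with hJ
  have hslope : ∀ τ, t < τ → slope J t τ =
      (∫ s in Ioo 0 t, (τ - t)⁻¹ • (heatExtension (g s) (τ - s) x - heatExtension (g s) (t - s) x)) +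
        (τ - t)⁻¹ • ∫ s in Ioo t τ, heatExtension (g s) (τ - s) x := by
    intro τ hτ
    rw [slope_def_module]
    have hsplit : J τ = (∫ s in Ioo 0 t, heatExtension (g s) (τ - s) x) +
        ∫ s in Ioo t τ, heatExtension (g s) (τ - s) x := setIntegral_Ioo_eq_add ht hτ.le (hint τ)
    have hI : (∫ s in Ioo 0 t, heatExtension (g s) (τ - s) x) - J t =
        ∫ s in Ioo 0 t, (heatExtension (g s) (τ - s) x - heatExtension (g s) (t - s) x) := by
      rw [hJ]
      exact (integral_sub (hint' hτ.le) (hint t)).symm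
    rw [hsplit, show ∀ a b c : F, a + b - c = (a - c) + b from fun a b c => by abel, hI, smul_add,
      ← integral_smul]
  -- ### the first piece: dominated convergence
  have hlimI : Tendsto (fun τ => ∫ s in Ioo 0 t,
      (τ - t)⁻¹ • (heatExtension (g s) (τ - s) x - heatExtension (g s) (t - s) x)) (𝓝[>] t)
      (𝓝 (∫ s in Ioo 0 t, heatExtension (Δ (g s)) (t - s) x)) := by
    refine tendsto_integral_filter_of_dominated_convergence (bound := fun _ => d * A) ?_ ?_ ?_ ?_
    · filter_upwards [self_mem_nhdsWithin] with τ _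
      exact ((aestronglyMeasurable_lift_apply hgm τ x _).sub (aestronglyMeasurable_lift_apply hgm t x _)).const_smul _
    · filter_upwards [self_mem_nhdsWithin] with τ hτ
      have hτt : 0 < τ - t := sub_pos.2 hτ
      filter_upwards [ae_restrict_mem measurableSet_Ioo] with s hs
      have hmv := norm_heatExtension_sub_heatExtension_le_of_C2 (hg s) (σ := t - s) (σ' := τ - s)
        (sub_pos.2 hs.2) (by linarith) x
      rw [norm_smul, norm_inv, Real.norm_of_nonneg hτt.le]
      calc (τ - t)⁻¹ * ‖heatExtension (g s) (τ - s) x - heatExtension (g s) (t - s) x‖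
          ≤ (τ - t)⁻¹ * (d * A * (τ - s - (t - s))) := by gcongr
        _ = d * A := by field_simp; ring
    · exact integrableOn_const (measure_Ioo_lt_top.ne)
    · filter_upwards [ae_restrict_mem measurableSet_Ioo] with s hs
      have hts : 0 < t - s := sub_pos.2 hs.2
      have hD : HasDerivAt (fun τ => heatExtension (g s) (τ - s) x) (heatExtension (Δ (g s)) (t - s) x) t := by
        have h := HasDerivAt.comp_add_const t (-s) (f := fun σ => heatExtension (g s) σ x)
          (by rw [← sub_eq_add_neg]; exact hderiv s (t - s) hts)
        simpa [sub_eq_add_neg] using h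
      have hsl := (hasDerivAt_iff_tendsto_slope.1 hD).mono_left (nhdsWithin_mono t fun τ hτ => ne_of_gt hτ)
      refine hsl.congr' ?_
      filter_upwards [self_mem_nhdsWithin] with τ _
      rw [slope_def_module]
  -- ### the second piece: the average of `e^{(τ−s)Δ}g(s)(x)` over `(t, τ)` tends to `g(t, x)`
  have hlimII : Tendsto (fun τ => (τ - t)⁻¹ • ∫ s in Ioo t τ, heatExtension (g s) (τ - s) x) (𝓝[>] t)
      (𝓝 (g t x)) := by
    rw [Metric.tendsto_nhdsWithin_nhds]
    intro ε hε
    obtain ⟨δ₁, hδ₁, hg_cont⟩ := (Metric.continuousWithinAt_iff.1 hcont) (ε / 2) (half_pos hε)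
    set δ : ℝ := min δ₁ (ε / (2 * (d * A + 1))) with hδ
    have hδ0 : 0 < δ := lt_min hδ₁ (by positivity)
    refine ⟨δ, hδ0, fun τ hτ hτδ => ?_⟩
    have hτt : 0 < τ - t := sub_pos.2 hτ
    rw [Real.dist_eq, abs_of_pos hτt] at hτδ
    rw [dist_eq_norm]
    -- pointwise bound on `(t, τ)`
    have hpt : ∀ s ∈ Ioo t τ, ‖heatExtension (g s) (τ - s) x - g t x‖ ≤ d * A * (τ - t) + ε / 2 := by
      intro s hs
      have hτs : 0 < τ - s := sub_pos.2 hs.2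
      have hsub : ‖heatExtension (g s) (τ - s) x - g s x‖ ≤ d * A * (τ - s) :=
        norm_heatExtension_sub_self_le_of_C2 (hg s).contDiff (h0 s) (h1 s) (h2' s) hτs x
      have hst : dist s t < δ₁ := by
        rw [Real.dist_eq, abs_of_pos (sub_pos.2 hs.1)]
        calc s - t < τ - t := by linarith [hs.2]
          _ < δ := hτδ
          _ ≤ δ₁ := min_le_left _ _
      have hgs : ‖g s x - g t x‖ < ε / 2 := by
        have h := hg_cont hs.1.le hst
        rwa [dist_eq_norm] at h
      calc ‖heatExtension (g s) (τ - s) x - g t x‖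
          ≤ ‖heatExtension (g s) (τ - s) x - g s x‖ + ‖g s x - g t x‖ :=
            norm_sub_le_norm_sub_add_norm_sub _ _ _
        _ ≤ d * A * (τ - s) + ε / 2 := add_le_add hsub hgs.le
        _ ≤ d * A * (τ - t) + ε / 2 := by gcongr; exact hs.1.le
    -- the average
    have hvol : (volume : Measure ℝ).real (Ioo t τ) = τ - t := by
      rw [measureReal_def, Real.volume_Ioo, ENNReal.toReal_ofReal hτt.le]
    have hconst : ∫ _ in Ioo t τ, g t x = (τ - t) • g t x := by
      rw [setIntegral_const, hvol]
    have hintτ : IntegrableOn (fun s => heatExtension (g s) (τ - s) x) (Ioo t τ) volume :=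
      (hint τ).mono_set (Ioo_subset_Ioo_left ht)
    have hdiff : (τ - t)⁻¹ • (∫ s in Ioo t τ, heatExtension (g s) (τ - s) x) - g t x =
        (τ - t)⁻¹ • ∫ s in Ioo t τ, (heatExtension (g s) (τ - s) x - g t x) := by
      rw [integral_sub hintτ (integrableOn_const (measure_Ioo_lt_top.ne)), hconst, smul_sub,
        inv_smul_smul₀ hτt.ne']
    rw [hdiff, norm_smul, norm_inv, Real.norm_of_nonneg hτt.le]
    have hI : ‖∫ s in Ioo t τ, (heatExtension (g s) (τ - s) x - g t x)‖ ≤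
        (d * A * (τ - t) + ε / 2) * (τ - t) := by
      have h := norm_setIntegral_le_of_norm_le_const (measure_Ioo_lt_top (μ := (volume : Measure ℝ)))
        hpt (f := fun s => heatExtension (g s) (τ - s) x - g t x)
      rwa [hvol] at h
    have hsmall : d * A * (τ - t) < ε / 2 := by
      have hτδ' : τ - t < ε / (2 * (d * A + 1)) := hτδ.trans_le (min_le_right _ _)
      have hfrac : d * A / (d * A + 1) < 1 := (div_lt_one (by positivity)).2 (by linarith)
      calc d * A * (τ - t) ≤ d * A * (ε / (2 * (d * A + 1))) := by gcongr
        _ = (d * A / (d * A + 1)) * (ε / 2) := by field_simp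
        _ < 1 * (ε / 2) := by gcongr
        _ = ε / 2 := one_mul _
    calc (τ - t)⁻¹ * ‖∫ s in Ioo t τ, (heatExtension (g s) (τ - s) x - g t x)‖
        ≤ (τ - t)⁻¹ * ((d * A * (τ - t) + ε / 2) * (τ - t)) := by gcongr
      _ = d * A * (τ - t) + ε / 2 := by field_simp
      _ < ε := by linarith
  -- ### conclusion
  rw [← hasDerivWithinAt_Ioi_iff_Ici,
    hasDerivWithinAt_iff_tendsto_slope' (show t ∉ Ioi t from fun h => lt_irrefl t h)]
  refine (hlimI.add hlimII).congr' ?_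
  filter_upwards [self_mem_nhdsWithin] with τ hτ
  exact (hslope τ hτ).symm

/-! ### From a continuous right derivative to the derivative -/

omit [CompleteSpace F] in
/-- **A continuous function with a continuous right derivative on an open interval is
differentiable there**, with that derivative: compare with the primitive `φ(a') + ∫_{a'}^r ψ`,
which has the same right derivative, by `eq_of_has_deriv_right_eq`. [folklore] -/
theorem hasDerivAt_of_hasDerivWithinAt_Ici [CompleteSpace F] {φ ψ : ℝ → F} {a b : ℝ}
    (hφ : ContinuousOn φ (Ioo a b)) (hψ : ContinuousOn ψ (Ioo a b))
    (hder : ∀ s ∈ Ioo a b, HasDerivWithinAt φ (ψ s) (Ici s) s) {s : ℝ} (hs : s ∈ Ioo a b) :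
    HasDerivAt φ (ψ s) s := by
  obtain ⟨a', ha', has'⟩ := exists_between hs.1
  obtain ⟨b', hsb', hb'⟩ := exists_between hs.2
  have hsub : Icc a' b' ⊆ Ioo a b := fun r hr => ⟨ha'.trans_le hr.1, hr.2.trans_lt hb'⟩
  -- the primitive
  set G : ℝ → F := fun r => φ a' + ∫ τ in a'..r, ψ τ with hG
  have hψi : ∀ r ∈ Icc a' b', IntervalIntegrable ψ volume a' r := fun r hr =>
    (hψ.mono ((Icc_subset_Icc_right hr.2).trans hsub)).intervalIntegrable_of_Icc hr.1
  have hGd : ∀ r ∈ Icc a' b', HasDerivAt G (ψ r) r := by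
    intro r hr
    have hro : r ∈ Ioo a b := hsub hr
    have hmeas : StronglyMeasurableAtFilter ψ (𝓝 r) volume :=
      hψ.stronglyMeasurableAtFilter isOpen_Ioo r hro
    have hcat : ContinuousAt ψ r := hψ.continuousAt (isOpen_Ioo.mem_nhds hro)
    exact (intervalIntegral.integral_hasDerivAt_right (hψi r hr) hmeas hcat).const_add (φ a')
  have heq : ∀ r ∈ Icc a' b', φ r = G r := by
    refine eq_of_has_deriv_right_eq (f' := ψ) (fun r hr => hder r (hsub ⟨hr.1, hr.2.le⟩))
      (fun r hr => (hGd r ⟨hr.1, hr.2.le⟩).hasDerivWithinAt) (hφ.mono hsub)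
      (fun r hr => (hGd r hr).continuousAt.continuousWithinAt) ?_
    simp [hG]
  have hev : φ =ᶠ[𝓝 s] G := by
    filter_upwards [Ioo_mem_nhds has' hsb'] with r hr using heq r ⟨hr.1.le, hr.2.le⟩
  exact (hGd s ⟨has'.le, hsb'.le⟩).congr_of_eventuallyEq hev

end SemilinearHeat

end Literature.Analysis.PDE
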